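import Summits.QuantumFields.BalabanUV.T4Continuum.Support.VariationalColourTaxiTowerEndMonotone
import Summits.QuantumFields.BalabanUV.T4Continuum.Support.VariationalVectorRegularityCovariant
import Summits.QuantumFields.BalabanUV.T4Continuum.Support.VariationalVectorGaugeSliceTower

/-!
# T⁴ programme, spine node NE2 (U1a), lane P2 — «V-COL-TAXI-END», part 6: BAŁABAN's COVARIANT PROJECTED GAUGE FUNCTIONAL AT BAŁABAN's TAXI DATA —
# EXISTENCE OF THE VECTOR TOWER LIMIT ⇐ (GF3) + (ONE-min), nothing else (leaf-10-g3's MONOTONE END p226720 instantiated at `G k := projG (Rlev k) (ker Q_{taxi})`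
# with leaf-03-g6's matrix form ∕ V-REG for `projG` WITH BACKGROUND p228016 and this lineage's taxi tower; model level; cell `pub-balaban`)

NE2 formalisation swarm `b2b-balaban-t4-ne2-formalise-*`, leaf prover 04 GEN 5 (`prover-b2b-balaban-t4-ne2-formalise-leaf-04-g5-0`); register row «P2-sup» of
`t4/formal/NE2/LEAVES.md`; journal CLAIMS.log «V-COL-TAXI-END» part 6 (INTENT 2026-08-20 17:15Z).  Compositions BY NAME of leaf-03-g6's
`VariationalVectorRegularityCovariant.{GmProj, GmProj_posSemidef, projG_eq_qform, hREG_projG}` (p228016), leaf-09-g6∕g7's `VariationalVectorGarding.{garding_of_poincare,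
qWV_le_of_poincare_divControl}` (p219068), `VariationalVectorGaugeSlice.{projG, avgOp, projG_le_divSq, projG_nonneg}` (p221888), `VariationalVectorGaugeSliceTower.Gtr_pullback`
(p222627), `VariationalVectorWeitzenbock.divSq_le_mul_roughV` (p218860), leaf-10-g3's `VariationalVectorEndMonotone.effV_tendsto_of_upper_geom` (p226720), and parts 4 ∕ 10 of this
lineage (`taxiClassPackage`, `exists_ubV_nestLv_ScV`, `qWV_le_nestLv`, `inBlock_blockOf_of_bpt`, (E_k) `nestLv_sub_lineT_le`); nothing defined — the functional is spelled out.

THE OBJECT.  At level `k`, on the carriers `QvL (L^k) M (nestLv k)` with bonds `Rlev k`, BAŁABAN's COVARIANT PROJECTED GAUGE FUNCTIONAL ([Balaban1985Propagators] (1.69)–(1.70)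
`‖(I − P)∂*A‖²` SHAPE, covariant version, in leaf-09-g7's function-world typing `projG R K W = ‖Π_{S_R(K)} div_R W‖²`) with the slice subspace
`K_k := ker (avgOp (L^k) M (taxiTv (L^k) M (Rlev k)))` — the block-mean-free 0-forms for the covariant scalar average in the STRAIGHT level-`k` TAXI frames (the frames
of reference of gen 4's V-UB ∕ V-P at taxi data); its matrix `GmProj` (leaf-03-g6: PSD, `projG = qform GmProj ∘ unc` at ANY transports); the one-step functional is the
PULLBACK of the next level's (`Gtr_pullback`, so the END's `hGtr` holds by construction).
 * §1 sockets at level `k`: `hGF_projG_taxi` ((GF1′), `C_G = d`, `C₀ = 0`); from ONE displayed coercivity binder **(GF3)_k** `(L^k)^{−d}((L^k)²·divSq_{Rlev k} W) ≤ C_D·ScV W +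
   C_D′·nsqV (Q W)`: `hGar_projG_nestLv` ((Går): `2(1+C_D)`, `2(C_D′ + 64·d((L^k)²a_k))`) and `hPc_projG_nestLv` (V-P: `max(80(1+C_D), 64 + 80(C_D′ + 64·d((L^k)²a_k)))`);
   `hUBc_projG_nestLv` (V-UB, constant `lamV d (…) d 0 ∕ (1 − κ⁻¹γ_k)²`); `hREG_projG_nestLv` (V-REG = leaf-03-g6's `hREG_projG` at `T := nestLv k`, frames the straight taxi with
   in-block mismatch `(d−1)(L^k−1)a_k` in block form; constant `8Λ + 2d(n²a)(CGar + CGar′) + (8·revPC² + 5d²(n²a)²)·C_P`).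
 * §2 **`effV_tendsto_taxiTower_projG_of_class`** — THE MONOTONE END FOR BAŁABAN's FUNCTIONAL AT BAŁABAN's TAXI DATA: `2 ≤ L`, `1 ≤ d`, `1 < M_μ`, a COHERENT tower of UNITARY
   one-step bond operators in the class `(L^{k+1})²b_k ≤ c` (part 2's three smallness conditions + `80·d·c ≤ 1`) ⟹ `∃ X∞, effV (L^k) M (Rlev k) (GmProj … (Rlev k) K_k)
   (QmL (L^k) M (nestLv k)) a → X∞`, Hermitian, nonnegative form, block-spin values converge — with DISPLAYED ONLY **(GF3)_k** (`0 ≤ C_D,k ≤ C_D⋆`, `0 ≤ C_D′,k ≤ C_D′⋆`) and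
   **(ONE-min)_k** (`ρV k = rhoV (L^k) M (Rlev k)`, `ε₁ k ≤ c_εθ^k`, `δ′ k ≤ c_δ′θ^k`, `0 ≤ θ < 1`); `C_R⋆ = 8Λ⋆ + 2dc(C_Gar⋆ + C_Gar′⋆) + (8(4d·36^d(1+(d−1)c)²)² + 5d²c²)·C_P⋆`.
HONEST, UP FRONT: (GF3) with background (the covariant [Balaban1985Propagators] (1.90)) and (ONE-min) with background are OPEN — leaf-03-g6's memo `t4/T4-EST-NE2-P2-REG.md` (kit j101794:
(GF3)∕V-P numerically n-uniform ≈ flat) and leaf-01-g7's memo `t4/T4-EST-NE2-P2-VGF.md` (V5); the choice `K_k` = straight-taxi kernel is OURS (a model choice, c5).  What is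
settled: for Bałaban's own gauge functional at curved data the EXISTENCE half of the vector END has exactly these two analytic inputs left.

HONEST FRAMING (T4-DAG p. 1).  Composition at MODEL level (`E = ℂ`; bond operators DATA; taxi ∕ straight contours and the slice subspace OURS; SHAPES only, no B0, c5); nothing
printed is a hypothesis; no `def`, no `def … : Prop`, no `sorry`; axioms standard.  V-END with background NOT proved; NE2 NOT proved on either road; NE3 OPEN; spine PROVED 0∕9
unchanged; rung (B)+1 finite T⁴ — NOT infinite volume, NOT mass gap, NOT Clay.  HONEST DEPENDENCY (cell, verbatim): continuum YM on T⁴ ⇐ BetaPertH ∧ nine spine estimates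
(0/9 proved); BetaPertH ⇐ (D1) ∧ (D4) ∧ CAP+tail; G-an2-4 gates asym, D1 and NE2/3/4.
-/

noncomputable section

namespace Summit.QuantumFields.BalabanUV.T4Continuum.VariationalColourTaxiTransport

open Finset Filter
open scoped Matrix ComplexOrder BigOperators Topology
open Literature.MathematicalPhysics.QuantumFieldTheory.Balaban1983to89.B5Prop11Plancherel (Tor fine unitVec)
open Literature.Analysis.Complex (qform)
open Summit.QuantumFields.BalabanUV.T4Continuum.VariationalTransfer (blockSpin)
open Summit.QuantumFields.BalabanUV.T4Continuum.VariationalColourFederbush (norm_le_one_of_mem_unitary)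
open Summit.QuantumFields.BalabanUV.T4Continuum.VariationalColourTower (Rtrv)
open Summit.QuantumFields.BalabanUV.T4Continuum.VariationalVectorFederbush (lineT)
open Summit.QuantumFields.BalabanUV.T4Continuum.VectorBlockTrialForm (nsqV nsqV_nonneg QvL roughV kappaV)
open Summit.QuantumFields.BalabanUV.T4Continuum.VariationalVectorForm (ScV SfV qWV lamV lamV_nonneg ScV_nonneg)
open Summit.QuantumFields.BalabanUV.T4Continuum.VariationalVectorEffective (unc effV)
open Summit.QuantumFields.BalabanUV.T4Continuum.VariationalVectorTower (Gtr QmL)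
open Summit.QuantumFields.BalabanUV.T4Continuum.VariationalVectorWeitzenbock (divSq divSq_le_mul_roughV)
open Summit.QuantumFields.BalabanUV.T4Continuum.VariationalVectorGarding (garding_of_poincare qWV_le_of_poincare_divControl)
open Summit.QuantumFields.BalabanUV.T4Continuum.VariationalVectorGaugeSlice (avgOp projG projG_le_divSq projG_nonneg)
open Summit.QuantumFields.BalabanUV.T4Continuum.VariationalVectorGaugeSliceTower (Gtr_pullback)
open Summit.QuantumFields.BalabanUV.T4Continuum.VariationalVectorOneStepPhys (rhoV rhoV_nonneg)
open Summit.QuantumFields.BalabanUV.T4Continuum.VariationalVectorRegularityCovariant (GmProj GmProj_posSemidef projG_eq_qform hREG_projG)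
open Summit.QuantumFields.BalabanUV.T4Continuum.CovariantBlockReversePoincare (revPC revPC_nonneg)
open Summit.QuantumFields.BalabanUV.T4Continuum.VariationalVectorEndMonotone (effV_tendsto_of_upper_geom)

variable {d : ℕ}
variable (L : ℕ) [NeZero L] (M : Fin d → ℕ) [hM : ∀ μ, NeZero (M μ)]
variable {R' : (k : ℕ) → Tor (fine L (fine (L ^ k) M)) → Fin d → (ℂ →L[ℂ] ℂ)}

/-! ## §1 The sockets for Bałaban's projected functional on the tower's carriers -/

section Sockets

variable (hU : ∀ k x μ, R' k x μ ∈ unitary (ℂ →L[ℂ] ℂ)) {b : ℕ → ℝ}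
  (hb : ∀ k x κ ι, ‖R' k x κ * R' k (x + unitVec (fine L (fine (L ^ k) M)) κ) ι - R' k x ι * R' k (x + unitVec (fine L (fine (L ^ k) M)) ι) κ‖ ≤ b k)
  (hcoh : ∀ k, coarseTv L (fine (L ^ (k + 1)) M) (R' (k + 1)) = Rtrv (L ^ k) L M (R' k))
include hU

/-- **(GF1′) FOR BAŁABAN's PROJECTED FUNCTIONAL**, any slice subspace: `projG R K W ≤ d·roughV R W + 0·Σ‖W‖²` (`projG ≤ divSq ≤ d·rough`). [folklore] -/
theorem hGF_projG_taxi (k : ℕ) (K : Submodule ℂ (Tor (fine (L ^ k) M) → ℂ)) (W : Tor (fine (L ^ k) M) → Fin d → ℂ) :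
    projG (fine (L ^ k) M) (Rlev L M R' k) K W ≤ d * roughV (L ^ k) M (Rlev L M R' k) W + 0 * nsqV (fine (L ^ k) M) W := by
  rw [zero_mul, add_zero]
  exact (projG_le_divSq _ _ K W).trans (divSq_le_mul_roughV (L ^ k) M (Rlev_mem_unitary L M hU k) W)

include hb hcoh

/-- **(Går) FOR BAŁABAN's PROJECTED FUNCTIONAL ON THE TOWER's CARRIERS, FROM (GF3)**: part 10's rough Poincaré (A = 64, B = 40) + the displayed coercivity binder through
leaf-09-g6's `garding_of_poincare`; smallness `80·d·((L^k)²a_k) ≤ 1` (+ part 10's two). [folklore] -/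
theorem hGar_projG_nestLv (hM2 : ∀ μ, 1 < M μ) (k : ℕ) {a : ℝ} (ha0 : 0 ≤ a)
    (ha : ∀ x κ ι, ‖Rlev L M R' k x κ * Rlev L M R' k (x + unitVec (fine (L ^ k) M) κ) ι - Rlev L M R' k x ι * Rlev L M R' k (x + unitVec (fine (L ^ k) M) ι) κ‖ ≤ a)
    (hsmall : 2 * (d : ℝ) * ((((L ^ k : ℕ) : ℝ)) * (((d - 1 : ℕ) : ℝ) * ((L ^ k - 1 : ℕ) : ℝ) * a)) ^ 2 ≤ 1 / 2)
    (hγs : 64 * (∑ q ∈ Finset.range k, ((((d - 1 : ℕ) : ℝ) + (d : ℝ) * d) * (((L : ℝ) * ((L ^ q - 1 : ℕ) : ℝ) * ((L - 1 : ℕ) : ℝ)) * b q))) ^ 2 ≤ 1)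
    (hsmall80 : 2 * 40 * ((d : ℝ) * ((((L ^ k : ℕ) : ℝ)) ^ 2 * a)) ≤ 1) (K : Submodule ℂ (Tor (fine (L ^ k) M) → ℂ)) {CD CD' : ℝ}
    (hGdiv : ∀ W, ((((L ^ k : ℕ) : ℝ)) ^ d)⁻¹ * ((((L ^ k : ℕ) : ℝ)) ^ 2 * divSq (fine (L ^ k) M) (Rlev L M R' k) W)
      ≤ CD * ScV (L ^ k) M (Rlev L M R' k) (projG (fine (L ^ k) M) (Rlev L M R' k) K) W + CD' * nsqV M (QvL (L ^ k) M (nestLv L M R' k) W))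
    (W : Tor (fine (L ^ k) M) → Fin d → ℂ) :
    ((((L ^ k : ℕ) : ℝ)) ^ d)⁻¹ * ((((L ^ k : ℕ) : ℝ)) ^ 2 * roughV (L ^ k) M (Rlev L M R' k) W)
      ≤ 2 * (1 + CD) * ScV (L ^ k) M (Rlev L M R' k) (projG (fine (L ^ k) M) (Rlev L M R' k) K) W
        + 2 * (CD' + d * ((((L ^ k : ℕ) : ℝ)) ^ 2 * a) * 64) * nsqV M (QvL (L ^ k) M (nestLv L M R' k) W) := by
  have hUk : ∀ x μ, Rlev L M R' k x μ ∈ unitary (ℂ →L[ℂ] ℂ) := Rlev_mem_unitary L M hU k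
  have hP := qWV_le_nestLv L M hU hb hcoh hM2 k ha hsmall hγs
  have h := garding_of_poincare (L ^ k) M hUk ha0 (fun x μ ν => ha x μ ν) (fun W => projG_nonneg _ _ K W) (Q := QvL (L ^ k) M (nestLv L M R' k))
    (CD := CD) (CD' := CD') (fun W => by simpa only [Nat.cast_pow] using hGdiv W) (A := 64) (B := 40)
    (fun W => by simpa only [Nat.cast_pow] using hP W) (by simpa only [Nat.cast_pow] using hsmall80) W
  simpa only [Nat.cast_pow] using h

/-- **V-P FOR BAŁABAN's PROJECTED FUNCTIONAL ON THE TOWER's CARRIERS, FROM (GF3)** (leaf-09-g6's `qWV_le_of_poincare_divControl` over part 10's rough Poincaré):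
`C_P = max(80(1+C_D), 64 + 80(C_D′ + 64·d((L^k)²a_k)))`. [folklore] -/
theorem hPc_projG_nestLv (hM2 : ∀ μ, 1 < M μ) (k : ℕ) {a : ℝ} (ha0 : 0 ≤ a)
    (ha : ∀ x κ ι, ‖Rlev L M R' k x κ * Rlev L M R' k (x + unitVec (fine (L ^ k) M) κ) ι - Rlev L M R' k x ι * Rlev L M R' k (x + unitVec (fine (L ^ k) M) ι) κ‖ ≤ a)
    (hsmall : 2 * (d : ℝ) * ((((L ^ k : ℕ) : ℝ)) * (((d - 1 : ℕ) : ℝ) * ((L ^ k - 1 : ℕ) : ℝ) * a)) ^ 2 ≤ 1 / 2)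
    (hγs : 64 * (∑ q ∈ Finset.range k, ((((d - 1 : ℕ) : ℝ) + (d : ℝ) * d) * (((L : ℝ) * ((L ^ q - 1 : ℕ) : ℝ) * ((L - 1 : ℕ) : ℝ)) * b q))) ^ 2 ≤ 1)
    (hsmall80 : 2 * 40 * ((d : ℝ) * ((((L ^ k : ℕ) : ℝ)) ^ 2 * a)) ≤ 1) (K : Submodule ℂ (Tor (fine (L ^ k) M) → ℂ)) {CD CD' : ℝ}
    (hGdiv : ∀ W, ((((L ^ k : ℕ) : ℝ)) ^ d)⁻¹ * ((((L ^ k : ℕ) : ℝ)) ^ 2 * divSq (fine (L ^ k) M) (Rlev L M R' k) W)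
      ≤ CD * ScV (L ^ k) M (Rlev L M R' k) (projG (fine (L ^ k) M) (Rlev L M R' k) K) W + CD' * nsqV M (QvL (L ^ k) M (nestLv L M R' k) W))
    (W : Tor (fine (L ^ k) M) → Fin d → ℂ) :
    qWV (L ^ k) M W ≤ max (40 * (2 * (1 + CD))) (64 + 40 * (2 * (CD' + d * ((((L ^ k : ℕ) : ℝ)) ^ 2 * a) * 64)))
      * (ScV (L ^ k) M (Rlev L M R' k) (projG (fine (L ^ k) M) (Rlev L M R' k) K) W + nsqV M (QvL (L ^ k) M (nestLv L M R' k) W)) := by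
  have hUk : ∀ x μ, Rlev L M R' k x μ ∈ unitary (ℂ →L[ℂ] ℂ) := Rlev_mem_unitary L M hU k
  have hP := qWV_le_nestLv L M hU hb hcoh hM2 k ha hsmall hγs
  have h := qWV_le_of_poincare_divControl (L ^ k) M hUk ha0 (fun x μ ν => ha x μ ν) (fun W => projG_nonneg _ _ K W)
    (Q := QvL (L ^ k) M (nestLv L M R' k)) (CD := CD) (CD' := CD') (fun W => by simpa only [Nat.cast_pow] using hGdiv W)
    (by norm_num : (0 : ℝ) ≤ 40) (fun W => by simpa only [Nat.cast_pow] using hP W) (by simpa only [Nat.cast_pow] using hsmall80) W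
  simpa only [Nat.cast_pow] using h

/-- **V-UB FOR BAŁABAN's PROJECTED FUNCTIONAL ON THE TOWER's CARRIERS**: part 10's `exists_ubV_nestLv_ScV` with (GF1′) := `hGF_projG_taxi` (`C_G = d`, `C₀ = 0`). [folklore] -/
theorem hUBc_projG_nestLv (hd : 1 ≤ d) (k : ℕ) {a : ℝ} (ha0 : 0 ≤ a)
    (ha : ∀ x κ ι, ‖Rlev L M R' k x κ * Rlev L M R' k (x + unitVec (fine (L ^ k) M) κ) ι - Rlev L M R' k x ι * Rlev L M R' k (x + unitVec (fine (L ^ k) M) ι) κ‖ ≤ a)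
    (hc : (kappaV d (L ^ k))⁻¹ * ((∑ q ∈ Finset.range k, ((((d - 1 : ℕ) : ℝ) + (d : ℝ) * d) * (((L : ℝ) * ((L ^ q - 1 : ℕ) : ℝ) * ((L - 1 : ℕ) : ℝ)) * b q)))
        + 3 * (((d - 1 : ℕ) : ℝ) * (L ^ k : ℕ) * ((L ^ k - 1 : ℕ) : ℝ) * a)) < 1) (K : Submodule ℂ (Tor (fine (L ^ k) M) → ℂ)) (φ : Tor M → Fin d → ℂ) :
    ∃ W : Tor (fine (L ^ k) M) → Fin d → ℂ, QvL (L ^ k) M (nestLv L M R' k) W = φ ∧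
      ScV (L ^ k) M (Rlev L M R' k) (projG (fine (L ^ k) M) (Rlev L M R' k) K) W
        ≤ lamV d ((L ^ k : ℕ) * (((d - 1 : ℕ) : ℝ) * ((L ^ k - 1 : ℕ) : ℝ) * a)) d (((L ^ k : ℕ) : ℝ) ^ 2 * 0)
          / (1 - (kappaV d (L ^ k))⁻¹ * ((∑ q ∈ Finset.range k, ((((d - 1 : ℕ) : ℝ) + (d : ℝ) * d) * (((L : ℝ) * ((L ^ q - 1 : ℕ) : ℝ) * ((L - 1 : ℕ) : ℝ)) * b q)))
              + 3 * (((d - 1 : ℕ) : ℝ) * (L ^ k : ℕ) * ((L ^ k - 1 : ℕ) : ℝ) * a))) ^ 2 * nsqV M φ :=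
  exists_ubV_nestLv_ScV L M hU hb hcoh k ha0 ha hd hc (Nat.cast_nonneg d) le_rfl (hGF_projG_taxi L M hU k K) φ

end Sockets

/-! ## §2 The monotone END for Bałaban's projected functional at taxi data: existence ⇐ (GF3) + (ONE-min) -/

section End

/-- **EXISTENCE OF THE VECTOR TOWER LIMIT AT BAŁABAN's TAXI DATA FOR BAŁABAN's COVARIANT PROJECTED GAUGE FUNCTIONAL ⇐ (GF3) + (ONE-min).**  `G k := projG (Rlev k) (ker Q_{taxi,k})`,
`Gm k := GmProj …` (leaf-03-g6: PSD + matrix form), one-step functional = pullback (`Gtr_pullback`); coarse V-UB ∕ V-P ∕ (Går) from §1, V-REG = leaf-03-g6's `hREG_projG`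
(frames the straight taxi, in-block mismatch in block form, (E_k)-near carriers are just «contractive `T`» there), class glue = `taxiClassPackage`; DISPLAYED ONLY the coercivity
binder (GF3)_k with uniform `C_D⋆`, `C_D′⋆` and (ONE-min)_k with geometric `ε₁`, `δ′` (`aa` = p226720's parameter `a`). [folklore] -/
theorem effV_tendsto_taxiTower_projG_of_class (hL : 2 ≤ L) (hd : 1 ≤ d) (hM2 : ∀ μ, 1 < M μ)
    -- the one-step bond data: unitary, plaquette class, coherent
    (hU : ∀ k x μ, R' k x μ ∈ unitary (ℂ →L[ℂ] ℂ)) {b : ℕ → ℝ} {c : ℝ}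
    (hb : ∀ k x κ ι, ‖R' k x κ * R' k (x + unitVec (fine L (fine (L ^ k) M)) κ) ι - R' k x ι * R' k (x + unitVec (fine L (fine (L ^ k) M)) ι) κ‖ ≤ b k)
    (hbc : ∀ k, (((L ^ (k + 1) : ℕ)) : ℝ) ^ 2 * b k ≤ c)
    (hcoh : ∀ k, coarseTv L (fine (L ^ (k + 1)) M) (R' (k + 1)) = Rtrv (L ^ k) L M (R' k))
    -- the polynomial smallness of the class constant
    (hsm1 : 60 * (6 : ℝ) ^ (d - 1) * ((2 * ((((d - 1 : ℕ) : ℝ) + (d : ℝ) * d)) + 3 * ((d - 1 : ℕ) : ℝ)) * c) ≤ 1 / 2)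
    (hsm2 : 2 * (d : ℝ) * ((((d - 1 : ℕ) : ℝ)) * c) ^ 2 ≤ 1 / 2) (hsm3 : 64 * (2 * ((((d - 1 : ℕ) : ℝ) + (d : ℝ) * d) * c)) ^ 2 ≤ 1)
    (hsm4 : 80 * ((d : ℝ) * c) ≤ 1)
    -- the DISPLAYED coercivity binder (GF3) of Bałaban's projected functional, per level, uniform constants
    {CD CD' : ℕ → ℝ} {CDs CDs' : ℝ} (hCD : ∀ k, 0 ≤ CD k) (hCDs : ∀ k, CD k ≤ CDs) (hCD' : ∀ k, 0 ≤ CD' k) (hCDs' : ∀ k, CD' k ≤ CDs')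
    (hGdiv : ∀ k W, ((((L ^ k : ℕ) : ℝ)) ^ d)⁻¹ * ((((L ^ k : ℕ) : ℝ)) ^ 2 * divSq (fine (L ^ k) M) (Rlev L M R' k) W)
      ≤ CD k * ScV (L ^ k) M (Rlev L M R' k) (projG (fine (L ^ k) M) (Rlev L M R' k) (LinearMap.ker (avgOp (L ^ k) M (taxiTv (L ^ k) M (Rlev L M R' k))))) W
        + CD' k * nsqV M (QvL (L ^ k) M (nestLv L M R' k) W))
    -- the effective-operator parameter, the decay rate and the DISPLAYED leaf (ONE-min)
    {aa : ℝ} (haa : 0 < aa) {θ : ℝ} (hθ : 0 ≤ θ) (hθ1 : θ < 1)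
    (ε₁ δ' : ℕ → ℝ) {cε cδ' : ℝ} (hε₁ : ∀ k, 0 ≤ ε₁ k) (hδ' : ∀ k, 0 ≤ δ' k) (hεθ : ∀ k, ε₁ k ≤ cε * θ ^ k) (hδ'θ : ∀ k, δ' k ≤ cδ' * θ ^ k)
    (hONEm : ∀ k (φ : Tor M → Fin d → ℂ) (W₀ : Tor (fine (L ^ k) M) → Fin d → ℂ), QvL (L ^ k) M (nestLv L M R' k) W₀ = φ →
      (∀ W, QvL (L ^ k) M (nestLv L M R' k) W = φ →
        ScV (L ^ k) M (Rlev L M R' k) (projG (fine (L ^ k) M) (Rlev L M R' k) (LinearMap.ker (avgOp (L ^ k) M (taxiTv (L ^ k) M (Rlev L M R' k))))) W₀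
          ≤ ScV (L ^ k) M (Rlev L M R' k) (projG (fine (L ^ k) M) (Rlev L M R' k) (LinearMap.ker (avgOp (L ^ k) M (taxiTv (L ^ k) M (Rlev L M R' k))))) W) →
      ∃ g, QvL (L ^ k) M (nestLv L M R' k) (QvL L (fine (L ^ k) M) (lineT L (fine (L ^ k) M) (taxiTv L (fine (L ^ k) M) (R' k)) (R' k)) g) = φ ∧
        SfV (L ^ k) L M (R' k)
            (fun W' => projG (fine (L ^ (k + 1)) M) (Rlev L M R' (k + 1)) (LinearMap.ker (avgOp (L ^ (k + 1)) M (taxiTv (L ^ (k + 1)) M (Rlev L M R' (k + 1)))))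
              (W' ∘ Literature.MathematicalPhysics.QuantumFieldTheory.Balaban1983to89.B5Composition116.sites (L ^ k) L M)) g
          ≤ (Real.sqrt (ScV (L ^ k) M (Rlev L M R' k) (projG (fine (L ^ k) M) (Rlev L M R' k) (LinearMap.ker (avgOp (L ^ k) M (taxiTv (L ^ k) M (Rlev L M R' k))))) W₀
                + ε₁ k * rhoV (L ^ k) M (Rlev L M R' k) W₀)
              + δ' k * Real.sqrt (qWV (L ^ k) M W₀)) ^ 2) :
    ∃ Xlim : Matrix (Tor M × Fin d) (Tor M × Fin d) ℂ,
      Tendsto (fun k => effV (L ^ k) M (Rlev L M R' k)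
        (GmProj (fine (L ^ k) M) (Rlev L M R' k) (LinearMap.ker (avgOp (L ^ k) M (taxiTv (L ^ k) M (Rlev L M R' k))))) (QmL (L ^ k) M (nestLv L M R' k)) aa)
        atTop (𝓝 Xlim) ∧ Xlim.IsHermitian ∧ (∀ v, 0 ≤ qform Xlim v) ∧
      ∀ φ : Tor M → Fin d → ℂ, Tendsto (fun k => blockSpin (QvL (L ^ k) M (nestLv L M R' k))
        (ScV (L ^ k) M (Rlev L M R' k) (projG (fine (L ^ k) M) (Rlev L M R' k) (LinearMap.ker (avgOp (L ^ k) M (taxiTv (L ^ k) M (Rlev L M R' k)))))) φ)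
        atTop (𝓝 (qform Xlim (unc φ))) := by
  have hR' : ∀ k x μ, ‖R' k x μ‖ ≤ 1 := fun k x μ => norm_le_one_of_mem_unitary (hU k x μ)
  have hPG0 : ∀ k W, 0 ≤ (projG (fine (L ^ k) M) (Rlev L M R' k) (LinearMap.ker (avgOp (L ^ k) M (taxiTv (L ^ k) M (Rlev L M R' k))))) W := fun k W => projG_nonneg _ _ _ W
  have hSc0 : ∀ k W, 0 ≤ ScV (L ^ k) M (Rlev L M R' k) (projG (fine (L ^ k) M) (Rlev L M R' k) (LinearMap.ker (avgOp (L ^ k) M (taxiTv (L ^ k) M (Rlev L M R' k))))) W := fun k W => ScV_nonneg (L ^ k) M _ (hPG0 k) W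
  -- the class package with the (GF1′) constants of `projG`: `C_G = d`, `C₀ = 0`
  obtain ⟨a, ha0, ha, hac, hκγ, hsmallP, hγs, -, hΛk⟩ := taxiClassPackage L M hL hd hU hb hbc hsm1 hsm2 hsm3 (CG := fun _ => (d : ℝ)) (C₀ := fun _ => 0)
    (CGs := (d : ℝ)) (c₀ := 0) (fun _ => Nat.cast_nonneg d) (fun _ => le_rfl) (fun _ => le_rfl) (fun _ => by simp)
  have hcUB : ∀ k, (kappaV d (L ^ k))⁻¹ * ((∑ q ∈ Finset.range k, ((((d - 1 : ℕ) : ℝ) + (d : ℝ) * d) * (((L : ℝ) * ((L ^ q - 1 : ℕ) : ℝ) * ((L - 1 : ℕ) : ℝ)) * b q)))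
      + 3 * (((d - 1 : ℕ) : ℝ) * (L ^ k : ℕ) * ((L ^ k - 1 : ℕ) : ℝ) * a k)) < 1 := fun k => lt_of_le_of_lt (hκγ k) (by norm_num)
  have hsmallp : ∀ k, 80 * ((d : ℝ) * ((((L ^ k : ℕ) : ℝ)) ^ 2 * a k)) ≤ 1 := fun k => by
    nlinarith [mul_le_mul_of_nonneg_left (hac k) (Nat.cast_nonneg (α := ℝ) d)]
  have hsmall80 : ∀ k, 2 * 40 * ((d : ℝ) * ((((L ^ k : ℕ) : ℝ)) ^ 2 * a k)) ≤ 1 := fun k => by linarith [hsmallp k]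
  have hda : ∀ k, (d : ℝ) * ((((L ^ k : ℕ) : ℝ)) ^ 2 * a k) ≤ d * c := fun k => mul_le_mul_of_nonneg_left (hac k) (Nat.cast_nonneg d)
  have hda0 : ∀ k, 0 ≤ (d : ℝ) * ((((L ^ k : ℕ) : ℝ)) ^ 2 * a k) := fun k => by have := ha0 k; positivity
  have hc0 : 0 ≤ c := le_trans (by have := ha0 0; positivity) (hac 0)
  -- uniform constants: V-UB, (Går), V-P, the reverse-Poincaré constant, V-REG
  set Λs : ℝ := 4 * lamV d (((d - 1 : ℕ) : ℝ) * c) (d : ℝ) 0 with hΛsdef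
  set CGars : ℝ := 2 * (1 + CDs) with hCGarsdef
  set CGars' : ℝ := 2 * (CDs' + (d : ℝ) * c * 64) with hCGars'def
  set CPs : ℝ := max (40 * (2 * (1 + CDs))) (64 + 40 * (2 * (CDs' + (d : ℝ) * c * 64))) with hCPsdef
  set RPs : ℝ := 4 * d * 36 ^ d * (1 + ((d - 1 : ℕ) : ℝ) * c) ^ 2 with hRPsdef
  set CRs : ℝ := 8 * Λs + 2 * d * c * (CGars + CGars') + (8 * RPs ^ 2 + 5 * (d : ℝ) ^ 2 * c ^ 2) * CPs with hCRsdef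
  have hΛk0 : ∀ k, 0 ≤ lamV d ((L ^ k : ℕ) * (((d - 1 : ℕ) : ℝ) * ((L ^ k - 1 : ℕ) : ℝ) * a k)) d (((L ^ k : ℕ) : ℝ) ^ 2 * 0)
      / (1 - (kappaV d (L ^ k))⁻¹ * ((∑ q ∈ Finset.range k, ((((d - 1 : ℕ) : ℝ) + (d : ℝ) * d) * (((L : ℝ) * ((L ^ q - 1 : ℕ) : ℝ) * ((L - 1 : ℕ) : ℝ)) * b q)))
          + 3 * (((d - 1 : ℕ) : ℝ) * (L ^ k : ℕ) * ((L ^ k - 1 : ℕ) : ℝ) * a k))) ^ 2 :=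
    fun k => div_nonneg (lamV_nonneg (Nat.cast_nonneg d) (by positivity)) (sq_nonneg _)
  have hΛs0 : 0 ≤ Λs := (hΛk0 0).trans (hΛk 0)
  have hCGark : ∀ k, 2 * (1 + CD k) ≤ CGars := fun k => by rw [hCGarsdef]; linarith [hCDs k]
  have hCGark' : ∀ k, 2 * (CD' k + d * ((((L ^ k : ℕ) : ℝ)) ^ 2 * a k) * 64) ≤ CGars' := fun k => by rw [hCGars'def]; nlinarith [hCDs' k, hda k]
  have hCGar0 : ∀ k, 0 ≤ 2 * (1 + CD k) := fun k => by have := hCD k; positivity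
  have hCGar0' : ∀ k, 0 ≤ 2 * (CD' k + d * ((((L ^ k : ℕ) : ℝ)) ^ 2 * a k) * 64) := fun k => by have := hCD' k; have := hda0 k; positivity
  have hCPk : ∀ k, max (40 * (2 * (1 + CD k))) (64 + 40 * (2 * (CD' k + d * ((((L ^ k : ℕ) : ℝ)) ^ 2 * a k) * 64))) ≤ CPs :=
    fun k => max_le_max (by linarith [hCGark k]) (by linarith [hCGark' k])
  have hCPk0 : ∀ k, 0 ≤ max (40 * (2 * (1 + CD k))) (64 + 40 * (2 * (CD' k + d * ((((L ^ k : ℕ) : ℝ)) ^ 2 * a k) * 64))) :=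
    fun k => le_max_of_le_left (by have := hCD k; positivity)
  have hCPs0 : 0 ≤ CPs := (hCPk0 0).trans (hCPk 0)
  have hRPk : ∀ k, revPC d (L ^ k) (((d - 1 : ℕ) : ℝ) * ((L ^ k - 1 : ℕ) : ℝ) * a k) ≤ RPs := fun k => by
    have h := blockDefect_le_of_class (d := d) L k (ha0 k) (hac k)
    have h0 : 0 ≤ ((L ^ k : ℕ) : ℝ) * (((d - 1 : ℕ) : ℝ) * ((L ^ k - 1 : ℕ) : ℝ) * a k) := by have := ha0 k; positivity
    unfold revPC
    rw [hRPsdef]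
    have h1 : (1 + ((L ^ k : ℕ) : ℝ) * (((d - 1 : ℕ) : ℝ) * ((L ^ k - 1 : ℕ) : ℝ) * a k)) ^ 2 ≤ (1 + ((d - 1 : ℕ) : ℝ) * c) ^ 2 :=
      pow_le_pow_left₀ (by positivity) (by linarith) 2
    exact mul_le_mul_of_nonneg_left h1 (by positivity)
  -- the sockets, weakened to the uniform constants
  have hUBc : ∀ k (φ : Tor M → Fin d → ℂ), ∃ W, QvL (L ^ k) M (nestLv L M R' k) W = φ ∧ ScV (L ^ k) M (Rlev L M R' k) (projG (fine (L ^ k) M) (Rlev L M R' k) (LinearMap.ker (avgOp (L ^ k) M (taxiTv (L ^ k) M (Rlev L M R' k))))) W ≤ Λs * nsqV M φ :=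
    fun k φ => by
    obtain ⟨W, hW, hS⟩ := hUBc_projG_nestLv L M hU hb hcoh hd k (ha0 k) (ha k) (hcUB k) (LinearMap.ker (avgOp (L ^ k) M (taxiTv (L ^ k) M (Rlev L M R' k)))) φ
    exact ⟨W, hW, hS.trans (mul_le_mul_of_nonneg_right (hΛk k) (nsqV_nonneg M φ))⟩
  have hGar : ∀ k W, ((((L ^ k : ℕ) : ℝ)) ^ d)⁻¹ * ((((L ^ k : ℕ) : ℝ)) ^ 2 * roughV (L ^ k) M (Rlev L M R' k) W)
      ≤ CGars * ScV (L ^ k) M (Rlev L M R' k) (projG (fine (L ^ k) M) (Rlev L M R' k) (LinearMap.ker (avgOp (L ^ k) M (taxiTv (L ^ k) M (Rlev L M R' k))))) W + CGars' * nsqV M (QvL (L ^ k) M (nestLv L M R' k) W) := fun k W => by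
    have h := hGar_projG_nestLv L M hU hb hcoh hM2 k (ha0 k) (ha k) (hsmallP k) (hγs k) (hsmall80 k) (LinearMap.ker (avgOp (L ^ k) M (taxiTv (L ^ k) M (Rlev L M R' k)))) (hGdiv k) W
    exact h.trans (add_le_add (mul_le_mul_of_nonneg_right (hCGark k) (hSc0 k W)) (mul_le_mul_of_nonneg_right (hCGark' k) (nsqV_nonneg M _)))
  have hPc : ∀ k W, qWV (L ^ k) M W ≤ CPs * (ScV (L ^ k) M (Rlev L M R' k) (projG (fine (L ^ k) M) (Rlev L M R' k) (LinearMap.ker (avgOp (L ^ k) M (taxiTv (L ^ k) M (Rlev L M R' k))))) W + nsqV M (QvL (L ^ k) M (nestLv L M R' k) W)) := fun k W => by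
    have h := hPc_projG_nestLv L M hU hb hcoh hM2 k (ha0 k) (ha k) (hsmallP k) (hγs k) (hsmall80 k) (LinearMap.ker (avgOp (L ^ k) M (taxiTv (L ^ k) M (Rlev L M R' k)))) (hGdiv k) W
    exact h.trans (mul_le_mul_of_nonneg_right (hCPk k) (add_nonneg (hSc0 k W) (nsqV_nonneg M _)))
  -- V-REG at every level (leaf-03-g6's `hREG_projG`; frames the straight level-`k` taxi)
  have hREG : ∀ k (φ : Tor M → Fin d → ℂ) W, QvL (L ^ k) M (nestLv L M R' k) W = φ →
      (∀ W₂, QvL (L ^ k) M (nestLv L M R' k) W₂ = φ → ScV (L ^ k) M (Rlev L M R' k) (projG (fine (L ^ k) M) (Rlev L M R' k) (LinearMap.ker (avgOp (L ^ k) M (taxiTv (L ^ k) M (Rlev L M R' k))))) W ≤ ScV (L ^ k) M (Rlev L M R' k) (projG (fine (L ^ k) M) (Rlev L M R' k) (LinearMap.ker (avgOp (L ^ k) M (taxiTv (L ^ k) M (Rlev L M R' k))))) W₂) →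
      rhoV (L ^ k) M (Rlev L M R' k) W ≤ CRs * (ScV (L ^ k) M (Rlev L M R' k) (projG (fine (L ^ k) M) (Rlev L M R' k) (LinearMap.ker (avgOp (L ^ k) M (taxiTv (L ^ k) M (Rlev L M R' k))))) W + nsqV M φ) := fun k φ W hW hmin => by
    have hUk : ∀ x μ, Rlev L M R' k x μ ∈ unitary (ℂ →L[ℂ] ℂ) := Rlev_mem_unitary L M hU k
    have hw := inBlock_blockOf_of_bpt (L ^ k) M hM2
      (P := fun x μ => ‖Rlev L M R' k x μ * star (taxiTv (L ^ k) M (Rlev L M R' k) (x + unitVec (fine (L ^ k) M) μ)) * taxiTv (L ^ k) M (Rlev L M R' k) x - 1‖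
        ≤ ((d - 1 : ℕ) : ℝ) * ((L ^ k - 1 : ℕ) : ℝ) * a k)
      (fun y j μ hj => inBlock_defect_taxiTv_adjoint_le (L ^ k) M hUk (ha k) y j μ hj)
    have hw0 : 0 ≤ ((d - 1 : ℕ) : ℝ) * ((L ^ k - 1 : ℕ) : ℝ) * a k := by have := ha0 k; positivity
    have h := hREG_projG (L ^ k) M hUk (ha0 k) (fun x μ ν => ha k x μ ν) (taxiTv_mem_unitary (L ^ k) M hUk) hw0 hw (norm_nestLv_le_one L M hR' k)
      (hΛk0 k) (hCGar0 k) (hCGar0' k) (hUBc_projG_nestLv L M hU hb hcoh hd k (ha0 k) (ha k) (hcUB k) (LinearMap.ker (avgOp (L ^ k) M (taxiTv (L ^ k) M (Rlev L M R' k)))))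
      (fun W => by simpa only [Nat.cast_pow] using hPc_projG_nestLv L M hU hb hcoh hM2 k (ha0 k) (ha k) (hsmallP k) (hγs k) (hsmall80 k) (LinearMap.ker (avgOp (L ^ k) M (taxiTv (L ^ k) M (Rlev L M R' k)))) (hGdiv k) W)
      (fun W => by simpa only [Nat.cast_pow] using hGar_projG_nestLv L M hU hb hcoh hM2 k (ha0 k) (ha k) (hsmallP k) (hγs k) (hsmall80 k) (LinearMap.ker (avgOp (L ^ k) M (taxiTv (L ^ k) M (Rlev L M R' k)))) (hGdiv k) W)
      φ W hW hmin
    have hS0' : 0 ≤ ScV (L ^ k) M (Rlev L M R' k) (projG (fine (L ^ k) M) (Rlev L M R' k) (LinearMap.ker (avgOp (L ^ k) M (taxiTv (L ^ k) M (Rlev L M R' k))))) W + nsqV M φ := add_nonneg (hSc0 k W) (nsqV_nonneg M φ)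
    -- `h` in this file's cast letters
    have h' : rhoV (L ^ k) M (Rlev L M R' k) W
        ≤ (8 * (lamV d ((L ^ k : ℕ) * (((d - 1 : ℕ) : ℝ) * ((L ^ k - 1 : ℕ) : ℝ) * a k)) d (((L ^ k : ℕ) : ℝ) ^ 2 * 0)
              / (1 - (kappaV d (L ^ k))⁻¹ * ((∑ q ∈ Finset.range k, ((((d - 1 : ℕ) : ℝ) + (d : ℝ) * d) * (((L : ℝ) * ((L ^ q - 1 : ℕ) : ℝ) * ((L - 1 : ℕ) : ℝ)) * b q)))
                + 3 * (((d - 1 : ℕ) : ℝ) * (L ^ k : ℕ) * ((L ^ k - 1 : ℕ) : ℝ) * a k))) ^ 2)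
            + 2 * d * ((((L ^ k : ℕ) : ℝ)) ^ 2 * a k) * (2 * (1 + CD k) + 2 * (CD' k + d * ((((L ^ k : ℕ) : ℝ)) ^ 2 * a k) * 64))
            + (8 * revPC d (L ^ k) (((d - 1 : ℕ) : ℝ) * ((L ^ k - 1 : ℕ) : ℝ) * a k) ^ 2 + 5 * (d : ℝ) ^ 2 * (((((L ^ k : ℕ) : ℝ)) ^ 2 * a k)) ^ 2)
              * max (40 * (2 * (1 + CD k))) (64 + 40 * (2 * (CD' k + d * ((((L ^ k : ℕ) : ℝ)) ^ 2 * a k) * 64))))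
          * (ScV (L ^ k) M (Rlev L M R' k) (projG (fine (L ^ k) M) (Rlev L M R' k) (LinearMap.ker (avgOp (L ^ k) M (taxiTv (L ^ k) M (Rlev L M R' k))))) W + nsqV M φ) := by
      simpa only [Nat.cast_pow] using h
    refine h'.trans (mul_le_mul_of_nonneg_right ?_ hS0')
    -- the level-`k` V-REG constant is below `CRs`
    have hRP := hRPk k
    have hRP0 : 0 ≤ revPC d (L ^ k) (((d - 1 : ℕ) : ℝ) * ((L ^ k - 1 : ℕ) : ℝ) * a k) := by unfold revPC; positivity
    have hG1 : 2 * (1 + CD k) + 2 * (CD' k + d * ((((L ^ k : ℕ) : ℝ)) ^ 2 * a k) * 64) ≤ CGars + CGars' := by linarith [hCGark k, hCGark' k]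
    have hG10 : 0 ≤ 2 * (1 + CD k) + 2 * (CD' k + d * ((((L ^ k : ℕ) : ℝ)) ^ 2 * a k) * 64) := add_nonneg (hCGar0 k) (hCGar0' k)
    have t1 : 8 * (lamV d ((L ^ k : ℕ) * (((d - 1 : ℕ) : ℝ) * ((L ^ k - 1 : ℕ) : ℝ) * a k)) d (((L ^ k : ℕ) : ℝ) ^ 2 * 0)
        / (1 - (kappaV d (L ^ k))⁻¹ * ((∑ q ∈ Finset.range k, ((((d - 1 : ℕ) : ℝ) + (d : ℝ) * d) * (((L : ℝ) * ((L ^ q - 1 : ℕ) : ℝ) * ((L - 1 : ℕ) : ℝ)) * b q)))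
            + 3 * (((d - 1 : ℕ) : ℝ) * (L ^ k : ℕ) * ((L ^ k - 1 : ℕ) : ℝ) * a k))) ^ 2) ≤ 8 * Λs := by linarith [hΛk k]
    have t2 : 2 * d * ((((L ^ k : ℕ) : ℝ)) ^ 2 * a k) * (2 * (1 + CD k) + 2 * (CD' k + d * ((((L ^ k : ℕ) : ℝ)) ^ 2 * a k) * 64))
        ≤ 2 * d * c * (CGars + CGars') := by
      have h1 : (d : ℝ) * ((((L ^ k : ℕ) : ℝ)) ^ 2 * a k) * (2 * (1 + CD k) + 2 * (CD' k + d * ((((L ^ k : ℕ) : ℝ)) ^ 2 * a k) * 64))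
          ≤ (d : ℝ) * c * (CGars + CGars') := mul_le_mul (hda k) hG1 hG10 (mul_nonneg (Nat.cast_nonneg d) hc0)
      calc 2 * (d : ℝ) * ((((L ^ k : ℕ) : ℝ)) ^ 2 * a k) * (2 * (1 + CD k) + 2 * (CD' k + d * ((((L ^ k : ℕ) : ℝ)) ^ 2 * a k) * 64))
          = 2 * ((d : ℝ) * ((((L ^ k : ℕ) : ℝ)) ^ 2 * a k) * (2 * (1 + CD k) + 2 * (CD' k + d * ((((L ^ k : ℕ) : ℝ)) ^ 2 * a k) * 64))) := by ring
        _ ≤ 2 * ((d : ℝ) * c * (CGars + CGars')) := by linarith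
        _ = 2 * d * c * (CGars + CGars') := by ring
    have t3 : (8 * revPC d (L ^ k) (((d - 1 : ℕ) : ℝ) * ((L ^ k - 1 : ℕ) : ℝ) * a k) ^ 2 + 5 * (d : ℝ) ^ 2 * (((((L ^ k : ℕ) : ℝ)) ^ 2 * a k)) ^ 2)
        * max (40 * (2 * (1 + CD k))) (64 + 40 * (2 * (CD' k + d * ((((L ^ k : ℕ) : ℝ)) ^ 2 * a k) * 64)))
        ≤ (8 * RPs ^ 2 + 5 * (d : ℝ) ^ 2 * c ^ 2) * CPs := by
      have hq : (d : ℝ) ^ 2 * (((((L ^ k : ℕ) : ℝ)) ^ 2 * a k)) ^ 2 ≤ (d : ℝ) ^ 2 * c ^ 2 := by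
        have h2 : ((d : ℝ) * ((((L ^ k : ℕ) : ℝ)) ^ 2 * a k)) ^ 2 ≤ ((d : ℝ) * c) ^ 2 := pow_le_pow_left₀ (hda0 k) (hda k) 2
        calc (d : ℝ) ^ 2 * (((((L ^ k : ℕ) : ℝ)) ^ 2 * a k)) ^ 2 = ((d : ℝ) * ((((L ^ k : ℕ) : ℝ)) ^ 2 * a k)) ^ 2 := by ring
          _ ≤ ((d : ℝ) * c) ^ 2 := h2
          _ = (d : ℝ) ^ 2 * c ^ 2 := by ring
      have hr : revPC d (L ^ k) (((d - 1 : ℕ) : ℝ) * ((L ^ k - 1 : ℕ) : ℝ) * a k) ^ 2 ≤ RPs ^ 2 := pow_le_pow_left₀ hRP0 hRP 2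
      have hsum : 8 * revPC d (L ^ k) (((d - 1 : ℕ) : ℝ) * ((L ^ k - 1 : ℕ) : ℝ) * a k) ^ 2 + 5 * (d : ℝ) ^ 2 * (((((L ^ k : ℕ) : ℝ)) ^ 2 * a k)) ^ 2
          ≤ 8 * RPs ^ 2 + 5 * (d : ℝ) ^ 2 * c ^ 2 := by linarith
      exact mul_le_mul hsum (hCPk k) (hCPk0 k) (by positivity)
    rw [hCRsdef]
    linarith [t1, t2, t3]
  exact effV_tendsto_of_upper_geom L M (Rlev L M R') R' (fun k => GmProj (fine (L ^ k) M) (Rlev L M R' k) (LinearMap.ker (avgOp (L ^ k) M (taxiTv (L ^ k) M (Rlev L M R' k)))))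
    (fun k => (projG (fine (L ^ k) M) (Rlev L M R' k) (LinearMap.ker (avgOp (L ^ k) M (taxiTv (L ^ k) M (Rlev L M R' k))))))
    (fun k => fun W' => (projG (fine (L ^ (k + 1)) M) (Rlev L M R' (k + 1)) (LinearMap.ker (avgOp (L ^ (k + 1)) M (taxiTv (L ^ (k + 1)) M (Rlev L M R' (k + 1)))))) (W' ∘ Literature.MathematicalPhysics.QuantumFieldTheory.Balaban1983to89.B5Composition116.sites (L ^ k) L M)) (nestLv L M R')
    (fun k => lineT L (fine (L ^ k) M) (taxiTv L (fine (L ^ k) M) (R' k)) (R' k)) (fun k => GmProj_posSemidef _ _ _)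
    (fun k W => projG_eq_qform _ _ _ W) (fun k => rfl) (fun k => rfl) (fun k => (Gtr_pullback (L ^ k) L M ((projG (fine (L ^ (k + 1)) M) (Rlev L M R' (k + 1)) (LinearMap.ker (avgOp (L ^ (k + 1)) M (taxiTv (L ^ (k + 1)) M (Rlev L M R' (k + 1)))))))).symm) haa
    (fun _ => Λs) (fun _ => CPs) (fun _ => CRs) ε₁ δ' (fun _ => hΛs0) (fun _ => le_rfl) (fun _ => hCPs0) (fun _ => le_rfl)
    (fun _ => by
      have : 0 ≤ 2 * d * c * (CGars + CGars') := by
        have : 0 ≤ CGars + CGars' := by linarith [hCGar0 0, hCGar0' 0, hCGark 0, hCGark' 0]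
        positivity
      have : 0 ≤ (8 * RPs ^ 2 + 5 * (d : ℝ) ^ 2 * c ^ 2) * CPs := by positivity
      rw [hCRsdef]; positivity)
    (fun _ => le_rfl) hε₁ hδ' hθ hθ1 hεθ hδ'θ (fun k W => rhoV_nonneg (L ^ k) M _ W) hUBc hPc hONEm hREG

end End

end Summit.QuantumFields.BalabanUV.T4Continuum.VariationalColourTaxiTransport

end
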